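import Mathlib
import Literature.Analysis.FluidPDE.VectorCalculus
import Literature.Analysis.FluidPDE.RapidDecayLemmas
import Summits.NavierStokesRegularity.NavierStokesRegularity.Theorems.PlaneEnergyCeilingSlabEnergyIdentitySlab
import Summits.NavierStokesRegularity.NavierStokesRegularity.Theorems.PlaneEnergyCeilingSlabEnergyIdentityPointwise
import Summits.NavierStokesRegularity.NavierStokesRegularity.Theorems.PlaneEnergyCeilingPlanarEnergyAPrioriStrainExcessPointwise
import Summits.NavierStokesRegularity.NavierStokesRegularity.Theorems.PlaneEnergyCeilingPlanarEnergyAPrioriPlanarFlux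

/-!
# Route PlaneEnergyCeiling · crux `PlanarEnergyAPriori` — strain-excess identity, decay bookkeeping

Helper file for the crux item stmt-NavierStokesRegularity-16855 (`PlanarEnergyAPriori`, route
`PlaneEnergyCeiling`), landed `--supports` that item. Second of three files proving the kinematic
HALF-SPACE STRAIN-EXCESS IDENTITY of the crux idea `gradient-trace-coulomb`
(`∫_{x₂=c} u₂² dA = ∫_{x₂>c} σ (x₂ − c) dx`, `σ = Σᵢⱼ ∂ᵢuⱼ ∂ⱼuᵢ`): here the decay bookkeeping.
For a `C²` field `u` with `‖u‖, ‖Du‖, ‖D²u‖ ≤ C(1 + ‖x‖)⁻⁷` (`C ≥ 1`):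

* pointwise bounds `O((1 + ‖x‖)⁻⁶)` on the four densities integrated in the assembly — the weighted
  convective flux `(x₂ − c)((u·∇)u)ⱼ` and its divergence density, the momentum flux `uⱼu₂` and its
  divergence density — and on the weighted strain excess `(x₂ − c)σ`
  (`norm_weight_mul_convect_le`, `norm_fderiv_weight_mul_convect_le`, `norm_apply_mul_apply_le`,
  `norm_fderiv_apply_mul_apply_le`, `norm_weight_mul_strainExcess_le`);
* integrability on `ℝ³` and on planes of `O((1 + ‖x‖)⁻⁶)` densities, the plane-integral bound
  `‖∫_{x₂=b} g‖ ≤ K·(∫_{ℝ²}(1+‖y‖)⁻⁴)·(1+|b|)⁻²` (`norm_integral_plane_le`), and the limits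
  `∫_{x₂=b} g → 0`, `(b − c)∫_{x₂=b} g → 0` as `b → +∞`
  (`tendsto_integral_plane_zero`, `tendsto_sub_mul_integral_plane_zero`).

Folklore.
-/

noncomputable section

-- single-conjunct summit: `Summit.<Summit>.<Problem>` repeats the name by the D-0017 layout
set_option linter.dupNamespace false

namespace Summit.NavierStokesRegularity.NavierStokesRegularity.Theorems.PlanarEnergyAPriori

open MeasureTheory Set Filter Topology WithLp
open scoped RealInnerProductSpace
open Literature.Analysis.FluidPDE
open Summit.NavierStokesRegularity.NavierStokesRegularity.Theorems.PlaneEnergyCeilingSlabEnergyIdentity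

/-! ### Weights -/

section Weights

variable {X : Type*} [SeminormedAddCommGroup X]

/-- `(1 + ‖x‖) · (1 + ‖x‖)⁻⁷ = (1 + ‖x‖)⁻⁶`. -/
theorem one_add_norm_mul_weight7 (x : X) :
    (1 + ‖x‖) * (1 + ‖x‖) ^ (-(7 : ℝ)) = (1 + ‖x‖) ^ (-(6 : ℝ)) := by
  have hx : (1 + ‖x‖) ≠ 0 := by positivity
  rw [show (-(6 : ℝ)) = -(7 : ℝ) + 1 by norm_num, Real.rpow_add_one hx, mul_comm]

/-- The height weight against the linear growth: `|x₂ − c| ≤ (1 + |c|)(1 + ‖x‖)`. -/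
theorem abs_coord_sub_le (x : EuclideanSpace ℝ (Fin 3)) (c : ℝ) : |x 2 - c| ≤ (1 + |c|) * (1 + ‖x‖) := by
  have h1 : |x 2| ≤ ‖x‖ := by simpa [Real.norm_eq_abs] using norm_apply_le_norm x 2
  have h2 : |x 2 - c| ≤ |x 2| + |c| := abs_sub _ _
  nlinarith [abs_nonneg c, norm_nonneg x, abs_nonneg (x 2)]

end Weights

/-! ### Second derivatives against the frame -/

/-- `‖D²u(x)(v, w)‖ ≤ ‖D²u(x)‖ ‖v‖ ‖w‖`. -/
theorem norm_fderiv_fderiv_apply_le (u : EuclideanSpace ℝ (Fin 3) → EuclideanSpace ℝ (Fin 3))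
    (x v w : EuclideanSpace ℝ (Fin 3)) :
    ‖fderiv ℝ (fderiv ℝ u) x v w‖ ≤ ‖iteratedFDeriv ℝ 2 u x‖ * ‖v‖ * ‖w‖ := by
  have h := (iteratedFDeriv ℝ 2 u x).le_opNorm ![v, w]
  rw [Fin.prod_univ_two, iteratedFDeriv_two_apply] at h
  simpa [mul_assoc] using h

/-! ### Pointwise bounds on the densities (decay exponent 7) -/

section Bounds

variable {u : EuclideanSpace ℝ (Fin 3) → EuclideanSpace ℝ (Fin 3)} {C : ℝ}
  (hC : 1 ≤ C)
  (h0 : ∀ x, ‖u x‖ ≤ C * (1 + ‖x‖) ^ (-(7 : ℝ)))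
  (h1 : ∀ x, ‖fderiv ℝ u x‖ ≤ C * (1 + ‖x‖) ^ (-(7 : ℝ)))
  (h2 : ∀ x, ‖iteratedFDeriv ℝ 2 u x‖ ≤ C * (1 + ‖x‖) ^ (-(7 : ℝ)))

include hC h1 in
/-- `‖Du‖ ≤ C`. -/
theorem norm_fderiv_le_const (x : EuclideanSpace ℝ (Fin 3)) : ‖fderiv ℝ u x‖ ≤ C :=
  (h1 x).trans (mul_le_of_le_one_right (by linarith) (rpow_neg_le_one x (by norm_num)))

include hC h0 in
/-- `‖u‖ ≤ C`. -/
theorem norm_le_const (x : EuclideanSpace ℝ (Fin 3)) : ‖u x‖ ≤ C :=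
  (h0 x).trans (mul_le_of_le_one_right (by linarith) (rpow_neg_le_one x (by norm_num)))

include hC h0 h1 in
/-- `‖(u·∇)u‖ ≤ C² (1 + ‖x‖)⁻⁷`. -/
theorem norm_convect_le (x : EuclideanSpace ℝ (Fin 3)) : ‖convect u u x‖ ≤ C ^ 2 * (1 + ‖x‖) ^ (-(7 : ℝ)) := by
  calc ‖convect u u x‖ = ‖fderiv ℝ u x (u x)‖ := rfl
    _ ≤ ‖fderiv ℝ u x‖ * ‖u x‖ := ContinuousLinearMap.le_opNorm _ _
    _ ≤ C * (C * (1 + ‖x‖) ^ (-(7 : ℝ))) :=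
        mul_le_mul (norm_fderiv_le_const hC h1 x) (h0 x) (norm_nonneg _) (by linarith)
    _ = C ^ 2 * (1 + ‖x‖) ^ (-(7 : ℝ)) := by ring

include hC h0 h1 in
/-- The weighted convective flux: `‖(x₂ − c)((u·∇)u)ⱼ‖ ≤ C²(1 + |c|)(1 + ‖x‖)⁻⁶`. -/
theorem norm_weight_mul_convect_le (c : ℝ) (x : EuclideanSpace ℝ (Fin 3)) (j : Fin 3) :
    ‖(x 2 - c) * convect u u x j‖ ≤ C ^ 2 * (1 + |c|) * (1 + ‖x‖) ^ (-(6 : ℝ)) := by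
  rw [norm_mul, Real.norm_eq_abs]
  have hw := one_add_norm_mul_weight7 x
  calc |x 2 - c| * ‖convect u u x j‖
      ≤ (1 + |c|) * (1 + ‖x‖) * (C ^ 2 * (1 + ‖x‖) ^ (-(7 : ℝ))) :=
        mul_le_mul (abs_coord_sub_le x c) ((norm_apply_le_norm _ j).trans (norm_convect_le hC h0 h1 x))
          (norm_nonneg _) (by positivity)
    _ = C ^ 2 * (1 + |c|) * ((1 + ‖x‖) * (1 + ‖x‖) ^ (-(7 : ℝ))) := by ring
    _ = C ^ 2 * (1 + |c|) * (1 + ‖x‖) ^ (-(6 : ℝ)) := by rw [hw]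

include hC h0 h1 h2 in
/-- The divergence density of the weighted convective flux:
`‖∂ⱼ[(x₂ − c)((u·∇)u)ⱼ]‖ ≤ 3C²(1 + |c|)(1 + ‖x‖)⁻⁶`. -/
theorem norm_fderiv_weight_mul_convect_le (hu : ContDiff ℝ 2 u) (c : ℝ) (x : EuclideanSpace ℝ (Fin 3)) (j : Fin 3) :
    ‖fderiv ℝ (fun y : EuclideanSpace ℝ (Fin 3) => (y 2 - c) * convect u u y j) x (EuclideanSpace.single j 1)‖ ≤
      3 * C ^ 2 * (1 + |c|) * (1 + ‖x‖) ^ (-(6 : ℝ)) := by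
  rw [fderiv_weight_mul_convect_apply hu c x _ j]
  have hw := one_add_norm_mul_weight7 x
  have hw7 : 0 ≤ (1 + ‖x‖) ^ (-(7 : ℝ)) := by positivity
  have hw76 : (1 + ‖x‖) ^ (-(7 : ℝ)) ≤ (1 + ‖x‖) ^ (-(6 : ℝ)) := rpow_neg_le_rpow_neg_of_le x (show (6 : ℝ) ≤ 7 by norm_num)
  have hc1 : (1 : ℝ) ≤ 1 + |c| := by linarith [abs_nonneg c]
  have hC0 : 0 ≤ C := by linarith
  -- the three pieces
  have hA : ‖fderiv ℝ u x (fderiv ℝ u x (EuclideanSpace.single j 1)) j‖ ≤ C ^ 2 * (1 + ‖x‖) ^ (-(7 : ℝ)) := by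
    calc _ ≤ ‖fderiv ℝ u x (fderiv ℝ u x (EuclideanSpace.single j 1))‖ := norm_apply_le_norm _ j
      _ ≤ ‖fderiv ℝ u x‖ * ‖fderiv ℝ u x (EuclideanSpace.single j 1)‖ := ContinuousLinearMap.le_opNorm _ _
      _ ≤ ‖fderiv ℝ u x‖ * ‖fderiv ℝ u x‖ := by gcongr; exact norm_fderiv_single_le u x j
      _ ≤ C * (C * (1 + ‖x‖) ^ (-(7 : ℝ))) :=
          mul_le_mul (norm_fderiv_le_const hC h1 x) (h1 x) (norm_nonneg _) hC0
      _ = C ^ 2 * (1 + ‖x‖) ^ (-(7 : ℝ)) := by ring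
  have hB : ‖fderiv ℝ (fderiv ℝ u) x (EuclideanSpace.single j 1) (u x) j‖ ≤ C ^ 2 * (1 + ‖x‖) ^ (-(7 : ℝ)) := by
    calc _ ≤ ‖fderiv ℝ (fderiv ℝ u) x (EuclideanSpace.single j 1) (u x)‖ := norm_apply_le_norm _ j
      _ ≤ ‖iteratedFDeriv ℝ 2 u x‖ * ‖(EuclideanSpace.single j (1 : ℝ) : EuclideanSpace ℝ (Fin 3))‖ * ‖u x‖ :=
          norm_fderiv_fderiv_apply_le u x _ _
      _ = ‖iteratedFDeriv ℝ 2 u x‖ * ‖u x‖ := by simp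
      _ ≤ C * (1 + ‖x‖) ^ (-(7 : ℝ)) * C :=
          mul_le_mul (h2 x) (norm_le_const hC h0 x) (norm_nonneg _) (by positivity)
      _ = C ^ 2 * (1 + ‖x‖) ^ (-(7 : ℝ)) := by ring
  have hD : ‖(EuclideanSpace.single j (1 : ℝ) : EuclideanSpace ℝ (Fin 3)) 2 * convect u u x j‖ ≤
      C ^ 2 * (1 + ‖x‖) ^ (-(7 : ℝ)) := by
    rw [norm_mul]
    have hs : ‖(EuclideanSpace.single j (1 : ℝ) : EuclideanSpace ℝ (Fin 3)) 2‖ ≤ 1 := by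
      fin_cases j <;> simp
    calc _ ≤ 1 * ‖convect u u x j‖ := by gcongr
      _ ≤ C ^ 2 * (1 + ‖x‖) ^ (-(7 : ℝ)) := by
          rw [one_mul]; exact (norm_apply_le_norm _ j).trans (norm_convect_le hC h0 h1 x)
  calc _ ≤ ‖(x 2 - c) * (fderiv ℝ u x (fderiv ℝ u x (EuclideanSpace.single j 1)) j +
          fderiv ℝ (fderiv ℝ u) x (EuclideanSpace.single j 1) (u x) j)‖ +
        ‖(EuclideanSpace.single j (1 : ℝ) : EuclideanSpace ℝ (Fin 3)) 2 * convect u u x j‖ := norm_add_le _ _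
    _ ≤ (1 + |c|) * (1 + ‖x‖) * (2 * (C ^ 2 * (1 + ‖x‖) ^ (-(7 : ℝ)))) + C ^ 2 * (1 + ‖x‖) ^ (-(7 : ℝ)) := by
        gcongr
        · rw [norm_mul, Real.norm_eq_abs]
          exact mul_le_mul (abs_coord_sub_le x c) ((norm_add_le _ _).trans (by linarith))
            (norm_nonneg _) (by positivity)
    _ = 2 * C ^ 2 * (1 + |c|) * ((1 + ‖x‖) * (1 + ‖x‖) ^ (-(7 : ℝ))) + C ^ 2 * (1 + ‖x‖) ^ (-(7 : ℝ)) := by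
        ring
    _ ≤ 2 * C ^ 2 * (1 + |c|) * (1 + ‖x‖) ^ (-(6 : ℝ)) + C ^ 2 * (1 + |c|) * (1 + ‖x‖) ^ (-(6 : ℝ)) := by
        rw [hw]
        gcongr _ + ?_
        calc C ^ 2 * (1 + ‖x‖) ^ (-(7 : ℝ)) = C ^ 2 * 1 * (1 + ‖x‖) ^ (-(7 : ℝ)) := by ring
          _ ≤ C ^ 2 * (1 + |c|) * (1 + ‖x‖) ^ (-(6 : ℝ)) := by gcongr
    _ = 3 * C ^ 2 * (1 + |c|) * (1 + ‖x‖) ^ (-(6 : ℝ)) := by ring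

include hC h0 in
/-- The momentum-flux density: `‖uⱼ u₂‖ ≤ C²(1 + ‖x‖)⁻⁶`. -/
theorem norm_apply_mul_apply_le (x : EuclideanSpace ℝ (Fin 3)) (j : Fin 3) :
    ‖u x j * u x 2‖ ≤ C ^ 2 * (1 + ‖x‖) ^ (-(6 : ℝ)) := by
  rw [norm_mul]
  calc ‖u x j‖ * ‖u x 2‖ ≤ ‖u x‖ * ‖u x‖ :=
        mul_le_mul (norm_apply_le_norm _ j) (norm_apply_le_norm _ 2) (norm_nonneg _) (norm_nonneg _)
    _ ≤ C * (C * (1 + ‖x‖) ^ (-(7 : ℝ))) := mul_le_mul (norm_le_const hC h0 x) (h0 x) (norm_nonneg _) (by linarith)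
    _ = C ^ 2 * (1 + ‖x‖) ^ (-(7 : ℝ)) := by ring
    _ ≤ C ^ 2 * (1 + ‖x‖) ^ (-(6 : ℝ)) :=
        mul_le_mul_of_nonneg_left (rpow_neg_le_rpow_neg_of_le x (show (6 : ℝ) ≤ 7 by norm_num)) (by positivity)

include hC h0 h1 in
/-- The divergence density of the momentum flux: `‖∂ⱼ(uⱼ u₂)‖ ≤ 2C²(1 + ‖x‖)⁻⁶`. -/
theorem norm_fderiv_apply_mul_apply_le (hu : Differentiable ℝ u) (x : EuclideanSpace ℝ (Fin 3)) (j : Fin 3) :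
    ‖fderiv ℝ (fun y => u y j * u y 2) x (EuclideanSpace.single j 1)‖ ≤ 2 * C ^ 2 * (1 + ‖x‖) ^ (-(6 : ℝ)) := by
  rw [fderiv_apply_mul_apply hu x _ j]
  have hk : ∀ i k : Fin 3, ‖u x i * fderiv ℝ u x (EuclideanSpace.single j 1) k‖ ≤ C ^ 2 * (1 + ‖x‖) ^ (-(6 : ℝ)) := by
    intro i k
    rw [norm_mul]
    calc ‖u x i‖ * ‖fderiv ℝ u x (EuclideanSpace.single j 1) k‖ ≤ ‖u x‖ * ‖fderiv ℝ u x‖ :=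
          mul_le_mul (norm_apply_le_norm _ i) ((norm_apply_le_norm _ k).trans (norm_fderiv_single_le u x j))
            (norm_nonneg _) (norm_nonneg _)
      _ ≤ C * (1 + ‖x‖) ^ (-(7 : ℝ)) * C := mul_le_mul (h0 x) (norm_fderiv_le_const hC h1 x) (norm_nonneg _) (by positivity)
      _ = C ^ 2 * (1 + ‖x‖) ^ (-(7 : ℝ)) := by ring
      _ ≤ C ^ 2 * (1 + ‖x‖) ^ (-(6 : ℝ)) :=
        mul_le_mul_of_nonneg_left (rpow_neg_le_rpow_neg_of_le x (show (6 : ℝ) ≤ 7 by norm_num)) (by positivity)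
  calc _ ≤ ‖u x j * fderiv ℝ u x (EuclideanSpace.single j 1) 2‖ + ‖u x 2 * fderiv ℝ u x (EuclideanSpace.single j 1) j‖ :=
        norm_add_le _ _
    _ ≤ C ^ 2 * (1 + ‖x‖) ^ (-(6 : ℝ)) + C ^ 2 * (1 + ‖x‖) ^ (-(6 : ℝ)) := add_le_add (hk j 2) (hk 2 j)
    _ = 2 * C ^ 2 * (1 + ‖x‖) ^ (-(6 : ℝ)) := by ring

include hC h1 in
/-- The weighted strain excess: `‖(x₂ − c) σ‖ ≤ 9C²(1 + |c|)(1 + ‖x‖)⁻⁶`. -/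
theorem norm_weight_mul_strainExcess_le (c : ℝ) (x : EuclideanSpace ℝ (Fin 3)) :
    ‖(x 2 - c) * ∑ i : Fin 3, ∑ j : Fin 3,
        fderiv ℝ u x (EuclideanSpace.single i 1) j * fderiv ℝ u x (EuclideanSpace.single j 1) i‖ ≤
      9 * C ^ 2 * (1 + |c|) * (1 + ‖x‖) ^ (-(6 : ℝ)) := by
  have hw := one_add_norm_mul_weight7 x
  have hterm : ∀ i j : Fin 3, ‖fderiv ℝ u x (EuclideanSpace.single i 1) j * fderiv ℝ u x (EuclideanSpace.single j 1) i‖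
      ≤ C ^ 2 * (1 + ‖x‖) ^ (-(7 : ℝ)) := by
    intro i j
    rw [norm_mul]
    calc _ ≤ ‖fderiv ℝ u x‖ * ‖fderiv ℝ u x‖ :=
          mul_le_mul ((norm_apply_le_norm _ j).trans (norm_fderiv_single_le u x i))
            ((norm_apply_le_norm _ i).trans (norm_fderiv_single_le u x j)) (norm_nonneg _) (norm_nonneg _)
      _ ≤ C * (C * (1 + ‖x‖) ^ (-(7 : ℝ))) := mul_le_mul (norm_fderiv_le_const hC h1 x) (h1 x) (norm_nonneg _) (by linarith)
      _ = C ^ 2 * (1 + ‖x‖) ^ (-(7 : ℝ)) := by ring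
  have hσ : ‖∑ i : Fin 3, ∑ j : Fin 3,
      fderiv ℝ u x (EuclideanSpace.single i 1) j * fderiv ℝ u x (EuclideanSpace.single j 1) i‖ ≤
      9 * (C ^ 2 * (1 + ‖x‖) ^ (-(7 : ℝ))) := by
    calc _ ≤ ∑ i : Fin 3, ‖∑ j : Fin 3, fderiv ℝ u x (EuclideanSpace.single i 1) j * fderiv ℝ u x (EuclideanSpace.single j 1) i‖ :=
          norm_sum_le _ _
      _ ≤ ∑ i : Fin 3, ∑ j : Fin 3, ‖fderiv ℝ u x (EuclideanSpace.single i 1) j * fderiv ℝ u x (EuclideanSpace.single j 1) i‖ :=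
          Finset.sum_le_sum fun i _ => norm_sum_le _ _
      _ ≤ ∑ _i : Fin 3, ∑ _j : Fin 3, C ^ 2 * (1 + ‖x‖) ^ (-(7 : ℝ)) :=
          Finset.sum_le_sum fun i _ => Finset.sum_le_sum fun j _ => hterm i j
      _ = 9 * (C ^ 2 * (1 + ‖x‖) ^ (-(7 : ℝ))) := by simp [Finset.sum_const]; ring
  rw [norm_mul, Real.norm_eq_abs]
  calc _ ≤ (1 + |c|) * (1 + ‖x‖) * (9 * (C ^ 2 * (1 + ‖x‖) ^ (-(7 : ℝ)))) :=
        mul_le_mul (abs_coord_sub_le x c) hσ (norm_nonneg _) (by positivity)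
    _ = 9 * C ^ 2 * (1 + |c|) * ((1 + ‖x‖) * (1 + ‖x‖) ^ (-(7 : ℝ))) := by ring
    _ = 9 * C ^ 2 * (1 + |c|) * (1 + ‖x‖) ^ (-(6 : ℝ)) := by rw [hw]

end Bounds

/-! ### Integrability and plane integrals of `O((1+‖x‖)⁻⁶)` densities -/

section Integrability

variable {F : Type*} [NormedAddCommGroup F] [NormedSpace ℝ F]

omit [NormedSpace ℝ F] in
/-- A continuous density `O((1+‖x‖)⁻⁶)` is integrable on `ℝ³`. -/
theorem integrable_of_norm_le_weight6 {g : EuclideanSpace ℝ (Fin 3) → F} (hg : Continuous g) {K : ℝ} (hK : 0 ≤ K)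
    (h : ∀ x, ‖g x‖ ≤ K * (1 + ‖x‖) ^ (-(6 : ℝ))) : Integrable g :=
  integrable_of_norm_le_weight hg fun x =>
    (h x).trans (mul_le_mul_of_nonneg_left (rpow_neg_le_rpow_neg_of_le x (show (4 : ℝ) ≤ 6 by norm_num)) hK)

omit [NormedSpace ℝ F] in
/-- A continuous density `O((1+‖x‖)⁻⁶)` has integrable slices on every plane `{x₂ = b}`. -/
theorem integrable_slice_of_norm_le_weight6 {g : EuclideanSpace ℝ (Fin 3) → F} (hg : Continuous g) {K : ℝ} (hK : 0 ≤ K)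
    (h : ∀ x, ‖g x‖ ≤ K * (1 + ‖x‖) ^ (-(6 : ℝ))) (b : ℝ) :
    Integrable fun y : EuclideanSpace ℝ (Fin 2) => g (toLp 2 ![y 0, y 1, b]) :=
  integrable_slice_of_norm_le_weight hg (fun x =>
    (h x).trans (mul_le_mul_of_nonneg_left (rpow_neg_le_rpow_neg_of_le x (show (4 : ℝ) ≤ 6 by norm_num)) hK)) b

/-- **Plane integrals of `O((1+‖x‖)⁻⁶)` densities are `O((1+|b|)⁻²)`**:
`‖∫_{x₂=b} g‖ ≤ K · (∫_{ℝ²}(1+‖y‖)⁻⁴) · (1+|b|)⁻²`. -/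
theorem norm_integral_plane_le {g : EuclideanSpace ℝ (Fin 3) → F} {K : ℝ} (hK : 0 ≤ K)
    (h : ∀ x, ‖g x‖ ≤ K * (1 + ‖x‖) ^ (-(6 : ℝ))) (b : ℝ) :
    ‖∫ y : EuclideanSpace ℝ (Fin 2), g (toLp 2 ![y 0, y 1, b])‖ ≤
      K * (∫ y : EuclideanSpace ℝ (Fin 2), (1 + ‖y‖) ^ (-(4 : ℝ))) * (1 + |b|) ^ (-(2 : ℝ)) := by
  have hr : (Module.finrank ℝ (EuclideanSpace ℝ (Fin 2)) : ℝ) < 4 := by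
    rw [finrank_euclideanSpace, Fintype.card_fin]; norm_num
  have hI : Integrable fun y : EuclideanSpace ℝ (Fin 2) => (1 + ‖y‖) ^ (-(4 : ℝ)) := integrable_one_add_norm hr
  have hpt : ∀ y : EuclideanSpace ℝ (Fin 2), ‖g (toLp 2 ![y 0, y 1, b])‖ ≤
      K * (1 + |b|) ^ (-(2 : ℝ)) * (1 + ‖y‖) ^ (-(4 : ℝ)) := by
    intro y
    set P : EuclideanSpace ℝ (Fin 3) := toLp 2 ![y 0, y 1, b] with hP
    have hP0 : 0 < 1 + ‖P‖ := by positivity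
    have hsplit : (1 + ‖P‖) ^ (-(6 : ℝ)) = (1 + ‖P‖) ^ (-(4 : ℝ)) * (1 + ‖P‖) ^ (-(2 : ℝ)) := by
      rw [← Real.rpow_add hP0]; norm_num
    have h4 : (1 + ‖P‖) ^ (-(4 : ℝ)) ≤ (1 + ‖y‖) ^ (-(4 : ℝ)) :=
      Real.rpow_le_rpow_of_nonpos (by positivity) (by linarith [norm_le_norm_toLp_vec3 y b]) (by norm_num)
    have h2 : (1 + ‖P‖) ^ (-(2 : ℝ)) ≤ (1 + |b|) ^ (-(2 : ℝ)) :=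
      Real.rpow_le_rpow_of_nonpos (by positivity) (by linarith [abs_le_norm_toLp_vec3 y b]) (by norm_num)
    calc ‖g P‖ ≤ K * (1 + ‖P‖) ^ (-(6 : ℝ)) := h P
      _ = K * ((1 + ‖P‖) ^ (-(4 : ℝ)) * (1 + ‖P‖) ^ (-(2 : ℝ))) := by rw [hsplit]
      _ ≤ K * ((1 + ‖y‖) ^ (-(4 : ℝ)) * (1 + |b|) ^ (-(2 : ℝ))) :=
          mul_le_mul_of_nonneg_left (mul_le_mul h4 h2 (by positivity) (by positivity)) hK
      _ = K * (1 + |b|) ^ (-(2 : ℝ)) * (1 + ‖y‖) ^ (-(4 : ℝ)) := by ring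
  calc ‖∫ y : EuclideanSpace ℝ (Fin 2), g (toLp 2 ![y 0, y 1, b])‖
      ≤ ∫ y : EuclideanSpace ℝ (Fin 2), ‖g (toLp 2 ![y 0, y 1, b])‖ := norm_integral_le_integral_norm _
    _ ≤ ∫ y : EuclideanSpace ℝ (Fin 2), K * (1 + |b|) ^ (-(2 : ℝ)) * (1 + ‖y‖) ^ (-(4 : ℝ)) :=
        integral_mono_of_nonneg (Eventually.of_forall fun y => norm_nonneg _) (hI.const_mul _)
          (Eventually.of_forall hpt)
    _ = K * (∫ y : EuclideanSpace ℝ (Fin 2), (1 + ‖y‖) ^ (-(4 : ℝ))) * (1 + |b|) ^ (-(2 : ℝ)) := by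
        rw [integral_const_mul]; ring

/-- `(1 + |b|)⁻ʳ → 0` as `b → +∞` (`r > 0`). -/
theorem tendsto_one_add_abs_rpow_neg {r : ℝ} (hr : 0 < r) :
    Tendsto (fun b : ℝ => (1 + |b|) ^ (-r)) atTop (𝓝 0) := by
  have h1 : Tendsto (fun b : ℝ => 1 + |b|) atTop atTop :=
    tendsto_atTop_add_const_left _ 1 tendsto_abs_atTop_atTop
  exact (tendsto_rpow_neg_atTop hr).comp h1

/-- **Plane integrals of `O((1+‖x‖)⁻⁶)` densities vanish at infinity.** -/
theorem tendsto_integral_plane_zero {g : EuclideanSpace ℝ (Fin 3) → F} {K : ℝ} (hK : 0 ≤ K)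
    (h : ∀ x, ‖g x‖ ≤ K * (1 + ‖x‖) ^ (-(6 : ℝ))) :
    Tendsto (fun b : ℝ => ∫ y : EuclideanSpace ℝ (Fin 2), g (toLp 2 ![y 0, y 1, b])) atTop (𝓝 0) := by
  refine squeeze_zero_norm (fun b => norm_integral_plane_le hK h b) ?_
  have := (tendsto_one_add_abs_rpow_neg (r := 2) two_pos).const_mul
    (K * ∫ y : EuclideanSpace ℝ (Fin 2), (1 + ‖y‖) ^ (-(4 : ℝ)))
  simpa using this

/-- **… even against the linear weight `b − c`.** -/
theorem tendsto_sub_mul_integral_plane_zero {g : EuclideanSpace ℝ (Fin 3) → ℝ} {K : ℝ} (hK : 0 ≤ K)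
    (h : ∀ x, ‖g x‖ ≤ K * (1 + ‖x‖) ^ (-(6 : ℝ))) (c : ℝ) :
    Tendsto (fun b : ℝ => (b - c) * ∫ y : EuclideanSpace ℝ (Fin 2), g (toLp 2 ![y 0, y 1, b])) atTop (𝓝 0) := by
  set I : ℝ := ∫ y : EuclideanSpace ℝ (Fin 2), (1 + ‖y‖) ^ (-(4 : ℝ)) with hI
  have hI0 : 0 ≤ I := integral_nonneg fun y => by positivity
  refine squeeze_zero_norm (a := fun b => K * I * (1 + |c|) * (1 + |b|) ^ (-(1 : ℝ))) (fun b => ?_) ?_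
  · rw [norm_mul, Real.norm_eq_abs]
    have hb : |b - c| ≤ (1 + |c|) * (1 + |b|) := by
      have := abs_sub b c
      nlinarith [abs_nonneg b, abs_nonneg c]
    have hsplit : (1 + |b|) * (1 + |b|) ^ (-(2 : ℝ)) = (1 + |b|) ^ (-(1 : ℝ)) := by
      have hb0 : (1 + |b|) ≠ 0 := by positivity
      rw [show (-(1 : ℝ)) = -(2 : ℝ) + 1 by norm_num, Real.rpow_add_one hb0, mul_comm]
    calc |b - c| * ‖∫ y : EuclideanSpace ℝ (Fin 2), g (toLp 2 ![y 0, y 1, b])‖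
        ≤ (1 + |c|) * (1 + |b|) * (K * I * (1 + |b|) ^ (-(2 : ℝ))) :=
          mul_le_mul hb (norm_integral_plane_le hK h b) (norm_nonneg _) (by positivity)
      _ = K * I * (1 + |c|) * ((1 + |b|) * (1 + |b|) ^ (-(2 : ℝ))) := by ring
      _ = K * I * (1 + |c|) * (1 + |b|) ^ (-(1 : ℝ)) := by rw [hsplit]
  · have := (tendsto_one_add_abs_rpow_neg (r := 1) one_pos).const_mul (K * I * (1 + |c|))
    simpa using this

/-- **`weightedPlaneIntegral_tendsto_zero`, registered form** (sub-goal of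
stmt-NavierStokesRegularity-16855; the limit step of the half-space strain-excess identity): for a
density `g = O((1+‖x‖)⁻⁶)` on `ℝ³`, `(b − c) ∫_{x₂=b} g → 0` as `b → +∞`. -/
theorem weightedPlaneIntegral_tendsto_zero : ∀ (g : EuclideanSpace ℝ (Fin 3) → ℝ) (K : ℝ), 0 ≤ K → (∀ x, ‖g x‖ ≤ K * (1 + ‖x‖) ^ (-(6 : ℝ))) → ∀ c : ℝ, Filter.Tendsto (fun b : ℝ => (b - c) * ∫ y : EuclideanSpace ℝ (Fin 2), g (WithLp.toLp 2 ![y 0, y 1, b])) Filter.atTop (nhds 0) :=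
  fun _ _ hK h c => tendsto_sub_mul_integral_plane_zero hK h c

end Integrability

end Summit.NavierStokesRegularity.NavierStokesRegularity.Theorems.PlanarEnergyAPriori

end
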